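import Mathlib.Tactic

/-!
# The decidability CEILING of a class floor under UND-primary router words, per A10 outcome

Venture CertifiedManyBodySolver, cell `pub/hubbard-downfold`, seat hubbard-downfold-score-2 (session g8,
2026-08-27T05:3xZ); namespace `Summit.Ventures.CertifiedManyBodySolver.Downfold.RouterCeiling`. Finite, PROVED
arithmetic; nothing here is about a material's physics.

WHAT THIS IS NOT: not the scorer of record (deputy-2 `score.py` v1.8), not a recommendation to adopt any A10 treatment
(ACCEPTANCE P-A10.5 decides BLIND on the Y37 hold-out margins; `RouterScore.recommend`, p475003), not a count of
decided materials. It is the kernel record of hubbard-downfold-score-1's FINDING F22 (2026-08-27T04:40:36Z, «DECIDABILITY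
CEILING») and of score-2's extension of it to the three A10 outcomes (`router_score.py a10 --consequence`, 2fbaf7a4, PREREG
§E 05:1xZ):

* F22: under ACCEPTANCE v1.8 §3.3 R-2W (a) and the assembler's cell precedence, a material whose PRIMARY router word is
  `UND:*` has every cell «undetermined (router:UND:…)», so no instrument can decide it. A §7 decided-fraction floor over a
  class of `n` non-exempt materials, `u` of which are bound to an UND primary on every worded column, therefore has a
  CEILING `n - u` on its decided count whatever S2/S3/e–ph deliver (`decided_le_ceiling`), and the floor «≥ need decided»
  is UNREACHABLE when `n - u < need` (`unreachable_of_ceiling_lt`).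
* v1 CUPRATE class today (RUN #12/#13 words of record): n = 19, floor 0.60 ⇒ need = ⌈0.60·19⌉ = 12 (`cuprateNeed`);
  (γ) keep the frozen words: u = 12 ⇒ ceiling 7 UNREACHABLE (`ceiling_gamma`); (γ) + the director's Q-CI-1 (B1) =
  ACCEPTANCE v1.9 §3.3 (e) (M13's CI default decides its cells): u = 11 ⇒ 8, UNREACHABLE (`ceiling_gamma_e`);
  (α) adopted: u = 4 ⇒ 15 ≥ 12 (`ceiling_alpha`); (β) adopted: u = 2 ⇒ 17 ≥ 12 (`ceiling_beta`). So among the REGISTERED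
  mechanisms only an adopted A10 treatment lifts the cuprate ceiling above the floor — a by-product that, by the Y62
  guard, may not enter the adoption decision; and a ceiling ≥ need is NECESSARY, not sufficient (`reach_needs_words`).
-/

namespace Summit.Ventures.CertifiedManyBodySolver.Downfold

namespace RouterCeiling

/-- A class for a §7 decided-fraction floor: `n` non-exempt materials, `und` of them bound to an `UND:*` primary on every
worded column (F22: undecidable by construction), `decided` of them decided by some instrument. [folklore] -/
structure ClassState where
  n : ℕ
  und : ℕ
  decided : ℕ
  und_le : und ≤ n
  /-- F22's structural fact: decided materials are among the non-UND-bound ones. -/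
  decided_le : decided ≤ n - und

/-- the decidability ceiling of the class. [folklore] -/
def ClassState.ceiling (c : ClassState) : ℕ := c.n - c.und

/-- F22: the decided count never exceeds the ceiling, whatever the instruments deliver. [folklore] -/
theorem decided_le_ceiling (c : ClassState) : c.decided ≤ c.ceiling := c.decided_le

/-- … hence a floor asking for `need` decided materials is UNREACHABLE when the ceiling is below `need`. [folklore] -/
theorem unreachable_of_ceiling_lt (c : ClassState) {need : ℕ} (h : c.ceiling < need) : c.decided < need :=
  lt_of_le_of_lt c.decided_le h

/-- Lifting materials off the UND primary (smaller `und`) raises the ceiling. [folklore] -/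
theorem ceiling_mono {n u₁ u₂ : ℕ} (h : u₂ ≤ u₁) : n - u₁ ≤ n - u₂ := Nat.sub_le_sub_left h n

/-- A ceiling at or above `need` is NECESSARY, not sufficient: with zero decided materials the floor still fails
(reaching it needs S2/S3/e–ph words on `need` materials). [folklore] -/
theorem reach_needs_words {n und need : ℕ} (hu : und ≤ n) (hc : need ≤ n - und) (hneed : 0 < need) :
    ∃ c : ClassState, c.n = n ∧ c.und = und ∧ need ≤ c.ceiling ∧ c.decided < need :=
  ⟨⟨n, und, 0, hu, Nat.zero_le _⟩, rfl, rfl, hc, hneed⟩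

/-! ## The v1 CUPRATE class today (19 non-exempt; ACCEPTANCE §7 floor 0.60) -/

/-- materials needed by a fractional floor `p/q` over `n`: the least `k` with `k/n ≥ p/q`, i.e. `⌈p·n/q⌉`. [folklore] -/
def need (p q n : ℕ) : ℕ := (p * n + q - 1) / q

/-- the cuprate floor 0.60 over 19 materials needs 12 (11/19 = 0.579 < 0.60 ≤ 12/19 = 0.632). [folklore] -/
theorem cuprateNeed : need 3 5 19 = 12 ∧ (11 : ℚ) / 19 < 3 / 5 ∧ (3 : ℚ) / 5 ≤ 12 / 19 := by
  refine ⟨by decide, by norm_num, by norm_num⟩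

/-- (γ) keep the frozen words: UND-bound = {#13 #14 #15 #16 #17 #19 #19b #20 #35 #37 #38 #50} = 12 ⇒ ceiling 7 < 12:
UNREACHABLE (F22's number). [folklore] -/
theorem ceiling_gamma : (19 - 12 : ℕ) = 7 ∧ 19 - 12 < need 3 5 19 := by decide

/-- (γ) + ACCEPTANCE v1.9 §3.3 (e) (director Q-CI-1 (B1): M13's CI default decides its cells): UND-bound 11 ⇒ 8 < 12:
still UNREACHABLE. [folklore] -/
theorem ceiling_gamma_e : (19 - 11 : ℕ) = 8 ∧ 19 - 11 < need 3 5 19 := by decide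

/-- (α) adopted (today's shadow rows re-route La-214 ×6 + Hg1201 #19/#19b off UND:MIXED; UND-bound left #20 #35 #37
#38 = 4) ⇒ ceiling 15 ≥ 12: reachable in principle. [folklore] -/
theorem ceiling_alpha : (19 - 4 : ℕ) = 15 ∧ need 3 5 19 ≤ 19 - 4 := by decide

/-- (β) adopted (+ #37 SLCO, #38 SCCO; UND-bound left #20 #35 = 2) ⇒ ceiling 17 ≥ 12. [folklore] -/
theorem ceiling_beta : (19 - 2 : ℕ) = 17 ∧ need 3 5 19 ≤ 19 - 2 := by decide

/-- (e) adds nothing on top of (α)/(β): M13 is already off the UND primary there (UND-bound sets unchanged). [folklore] -/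
theorem ceiling_alpha_e_beta_e : (19 - 4 : ℕ) = 15 ∧ (19 - 2 : ℕ) = 17 := by decide

/-- The table in one statement: under (γ) and (γ)+(e) every cuprate `ClassState` misses the floor; under (α)/(β) the
ceiling no longer forbids it. [folklore] -/
theorem cuprate_table (c : ClassState) (hn : c.n = 19) :
    (c.und = 12 → c.decided < 12) ∧ (c.und = 11 → c.decided < 12) ∧
    (c.und = 4 → 12 ≤ c.ceiling) ∧ (c.und = 2 → 12 ≤ c.ceiling) := by
  refine ⟨fun hu => ?_, fun hu => ?_, fun hu => ?_, fun hu => ?_⟩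
  · exact unreachable_of_ceiling_lt c (by simp [ClassState.ceiling, hn, hu])
  · exact unreachable_of_ceiling_lt c (by simp [ClassState.ceiling, hn, hu])
  · simp [ClassState.ceiling, hn, hu]
  · simp [ClassState.ceiling, hn, hu]

end RouterCeiling

end Summit.Ventures.CertifiedManyBodySolver.Downfold
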